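import Summits.ABC.IUTFork.Repair.RHToptKnapsackDual
import HarnessLib

/-!
# R-H D-0121 (1)(b) T-OPTIMALITY — the cell LP is DEGENERATE: dual multiplier `1`, value `min(M, mass(σ) + C_σ)`, optimality ⟺ full
# spend, and the conceded mass `ε` is invariant under every scheme with the same total spend («no greedy law is forced»; PROOF-ONLY, 0 defs)

abc-iut cell, rung LADDER-ABC:A2.RESCUE.H; seat abc-iut-topt-pv-2; rh-lead g3 ruling **R29 (3)** (STATUS 2026-08-27T02:42:43Z, T-OPTIMALITY SPEC v0.2 =
rh3-ref-1 02:36:02Z referee input adopted): «topt-pv-2 — the “forced weight law” becomes the DEGENERACY/DUAL theorem: for the cell LP at either information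
level the dual multiplier is 1, the value is min(M, Π) (resp. μ₄M + C_σ), and ε is invariant under every ω with the same total spend (no greedy law is
forced — THAT is the finding)». Sequel of `Repair/RHToptKnapsackDual.lean` (p488805; notation as there):
    (P) maximise the kept mass `Σ_{c∈s} ω c·t c` over `0 ≤ ω ≤ 1` subject to the netting row `Σ_{c∈s} ω c·ŝ c ≥ 0`;  (D) `g(y) = Σ_c max(t c + y·ŝ c, 0)`.
THE STRUCTURE OF THE CELL TABLE (D0121-SPEC §1.0, R29 (1)): a cell is either LICENSED (`ŝ c ≥ 0`: certified surplus `s(c)`; in the cell reading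
`Σ_{ŝ≥0} t = mass(σ)`, `Σ_{ŝ≥0} ŝ = C_σ`) or a DEFICIT cell whose debt EQUALS its mass — **UNIT RATIO** `ŝ c = −t c` (information level LIC: off `σ`
only the honest cone `d ≤ t` is known, so netting a cell costs exactly what it keeps; information level EX: the same table with `t` replaced by the
certified deficit `u = t − price ≥ 0` of the unlicensed cells). Every deficit cell then has value/cost ratio `1`, so:
* §1 `dual_at_one_eq` — the dual value at `y = 1` is `g(1) = Σ_{ŝ ≥ 0} (t + ŝ)` (`= mass(σ) + C_σ`); `kept_le_surplusValue` — every feasible scheme keeps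
  `≤ mass(σ) + C_σ` (weak duality at `y = 1`; conceded mass `ε ≥ T − C_σ`, `T = M − mass(σ)`), and `kept_le_total` (`≤ M`).
* §2 DEGENERACY `kept_eq_surplusValue_iff` — a feasible scheme is OPTIMAL (keeps exactly `mass(σ) + C_σ`) **iff** it spends the whole surplus
  (`Σ ω ŝ = 0`) and keeps whole every licensed cell of positive value; NOTHING is required of the deficit cells individually (at `y = 1` they are all tie
  cells of §3 of p488805). `kept_eq_of_spend_eq` — the kept mass (hence `ε`) depends on `ω` only through its licensed part and its TOTAL deficit spend
  `Σ_{ŝ<0} ω t`: any redistribution of the spend over the unlicensed cells is again optimal (`optimal_of_redistribution`).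
* §3 ATTAINMENT without greed: if the debt `Σ_{ŝ<0} t` exceeds the surplus `C_σ`, the UNIFORM scheme (`ω = 1` on licensed cells, the common fraction
  `θ = C_σ / Σ_{ŝ<0} t` on every deficit cell) is feasible and optimal (`uniform_optimal`); otherwise `ω ≡ 1` is (`all_optimal_of_debt_le`). So
  `max (P) = min(M, mass(σ) + C_σ)` — R29's «LIC/netting `ε = T − C_σ`», and with `t ↦ u`: «EX/netting `ε = (M − Π)⁺`».
* §4 THE REFEREE'S EX REMARK `sum_le_weightedConcession` — with certified deficit bounds `u ≤ t` on every cell, the plainly netted statement is at least as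
  sharp as every weighted-door concession: `Σ ω u ≤ 0 ⟹ Σ u ≤ Σ (1 − ω)·t`. (Reading: p479556 `StatementUpTo P ε ⟺ PN Σᶠ d ≤ ε` with the exact cell on
  every cell gives `ε = M − Π` directly; p480491's weighted door with any `ω` is weaker or equal — rh3-ref-1 02:36:02Z, R29 (1).)
HONEST FRAMING: elementary LP arithmetic about a finite table of numbers; nothing here asserts that abc is proved or refuted, or that [IUTchIII] Cor. 3.12 /
[IUTchIV] Thm. 1.10 holds or fails at any datum, or takes a side on any author; the reading «table ↔ datum» is the kit certificate (computed ≠ proved);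
typed ≠ proved. [folklore] throughout.
-/

namespace Summit.ABC.IUTFork.Repair.RH.ToptKnapsack

open Finset

variable {ι 𝕜 : Type*} [Field 𝕜] [LinearOrder 𝕜] [IsStrictOrderedRing 𝕜]

/-! ## §1. The dual at `y = 1` and the value bound `min(M, mass(σ) + C_σ)` -/

section DualAtOne

variable {s : Finset ι} {t ŝ ω : ι → 𝕜}

/-- Under UNIT RATIO every reduced cost at `y = 1` is non-negative: `t c + ŝ c ≥ 0` (licensed: `t, ŝ ≥ 0`; deficit: `= 0`). [folklore] -/
theorem reducedCost_one_nonneg (ht : ∀ c ∈ s, 0 ≤ t c) (hunit : ∀ c ∈ s, ŝ c < 0 → ŝ c = -t c) {c : ι} (hc : c ∈ s) :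
    0 ≤ t c + ŝ c := by
  rcases le_or_gt 0 (ŝ c) with h | h
  · exact add_nonneg (ht c hc) h
  · rw [hunit c hc h, add_neg_cancel]

/-- **THE DUAL AT `y = 1`.** Under unit ratio and `t ≥ 0`: `g(1) = Σ_c max(t c + 1·ŝ c, 0) = Σ_{c : ŝ c ≥ 0} (t c + ŝ c)` — in the cell reading
`mass(σ) + C_σ` (licensed mass plus certified surplus); the deficit cells contribute `max(0,0) = 0`. [folklore] -/
theorem dual_at_one_eq (ht : ∀ c ∈ s, 0 ≤ t c) (hunit : ∀ c ∈ s, ŝ c < 0 → ŝ c = -t c) :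
    ∑ c ∈ s, max (t c + 1 * ŝ c) 0 = ∑ c ∈ s.filter (fun c => 0 ≤ ŝ c), (t c + ŝ c) := by
  rw [← Finset.sum_filter_add_sum_filter_not s (fun c => 0 ≤ ŝ c)]
  have h1 : ∑ c ∈ s.filter (fun c => 0 ≤ ŝ c), max (t c + 1 * ŝ c) 0 = ∑ c ∈ s.filter (fun c => 0 ≤ ŝ c), (t c + ŝ c) :=
    Finset.sum_congr rfl fun c hc => by
      obtain ⟨hcs, hsc⟩ := Finset.mem_filter.mp hc
      rw [one_mul, max_eq_left (add_nonneg (ht c hcs) hsc)]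
  have h2 : ∑ c ∈ s.filter (fun c => ¬ 0 ≤ ŝ c), max (t c + 1 * ŝ c) 0 = 0 :=
    Finset.sum_eq_zero fun c hc => by
      obtain ⟨hcs, hsc⟩ := Finset.mem_filter.mp hc
      rw [one_mul, hunit c hcs (not_le.mp hsc), add_neg_cancel, max_self]
  rw [h1, h2, add_zero]

/-- **VALUE BOUND (weak duality at `y = 1`).** Under unit ratio, every feasible scheme keeps at most `Σ_{ŝ ≥ 0} (t + ŝ)` (`= mass(σ) + C_σ`): the conceded
mass `ε = M − Σ ω t` of ANY averaging scheme is `≥ T − C_σ`, `T := M − mass(σ)` — R29's LIC/netting floor. [folklore] -/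
theorem kept_le_surplusValue (ht : ∀ c ∈ s, 0 ≤ t c) (hunit : ∀ c ∈ s, ŝ c < 0 → ŝ c = -t c)
    (h0 : ∀ c ∈ s, 0 ≤ ω c) (h1 : ∀ c ∈ s, ω c ≤ 1) (hnet : 0 ≤ ∑ c ∈ s, ω c * ŝ c) :
    ∑ c ∈ s, ω c * t c ≤ ∑ c ∈ s.filter (fun c => 0 ≤ ŝ c), (t c + ŝ c) := by
  rw [← dual_at_one_eq ht hunit]
  exact kept_le_dual h0 h1 hnet zero_le_one

/-- … and trivially at most the total mass `M = Σ t` (no netting needed). [folklore] -/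
theorem kept_le_total (ht : ∀ c ∈ s, 0 ≤ t c) (h0 : ∀ c ∈ s, 0 ≤ ω c) (h1 : ∀ c ∈ s, ω c ≤ 1) :
    ∑ c ∈ s, ω c * t c ≤ ∑ c ∈ s, t c :=
  Finset.sum_le_sum fun c hc => by
    have := mul_le_mul_of_nonneg_right (h1 c hc) (ht c hc)
    have h0c := h0 c hc
    linarith

omit [IsStrictOrderedRing 𝕜] in
/-- The surplus value splits as licensed mass plus certified surplus: `Σ_{ŝ≥0}(t + ŝ) = Σ_{ŝ≥0} t + Σ_{ŝ≥0} ŝ` (`mass(σ) + C_σ`). [folklore] -/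
theorem surplusValue_eq_mass_add_credit :
    ∑ c ∈ s.filter (fun c => 0 ≤ ŝ c), (t c + ŝ c) =
      ∑ c ∈ s.filter (fun c => 0 ≤ ŝ c), t c + ∑ c ∈ s.filter (fun c => 0 ≤ ŝ c), ŝ c :=
  Finset.sum_add_distrib

end DualAtOne

/-! ## §2. DEGENERACY: optimality ⟺ full spend; the conceded mass depends only on the total spend -/

section Degeneracy

variable {s : Finset ι} {t ŝ ω ω' : ι → 𝕜}

/-- **DEGENERACY OF THE CELL LP.** Under unit ratio and `t ≥ 0`, a feasible scheme `ω` is OPTIMAL — keeps exactly `Σ_{ŝ≥0}(t + ŝ) = mass(σ) + C_σ` —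
**iff** (i) it spends the whole surplus, `Σ ω ŝ = 0`, and (ii) it keeps whole every licensed cell of positive value (`t c + ŝ c > 0 ⟹ ω c = 1`).
No condition bears on any individual deficit cell: at the multiplier `y = 1` every unlicensed cell is a tie cell (reduced cost `t − t = 0`), so the
«greedy-by-ratio» law of p488805 §3 forces nothing there — THAT is the finding of R29 (3). [folklore] -/
theorem kept_eq_surplusValue_iff (ht : ∀ c ∈ s, 0 ≤ t c) (hunit : ∀ c ∈ s, ŝ c < 0 → ŝ c = -t c)
    (h0 : ∀ c ∈ s, 0 ≤ ω c) (h1 : ∀ c ∈ s, ω c ≤ 1) (hnet : 0 ≤ ∑ c ∈ s, ω c * ŝ c) :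
    ∑ c ∈ s, ω c * t c = ∑ c ∈ s.filter (fun c => 0 ≤ ŝ c), (t c + ŝ c) ↔
      ∑ c ∈ s, ω c * ŝ c = 0 ∧ ∀ c ∈ s, 0 < t c + ŝ c → ω c = 1 := by
  rw [← dual_at_one_eq ht hunit, kept_eq_dual_iff h0 h1 hnet zero_le_one, one_mul]
  refine ⟨fun h => ⟨h.1, fun c hc hpos => (h.2 c hc).1 (by rwa [one_mul])⟩, fun h => ⟨h.1, fun c hc => ⟨fun hpos => ?_, fun hneg => ?_⟩⟩⟩
  · exact h.2 c hc (by rwa [one_mul] at hpos)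
  · rw [one_mul] at hneg
    exact absurd hneg (not_lt.mpr (reducedCost_one_nonneg ht hunit hc))

omit [IsStrictOrderedRing 𝕜] in
/-- **THE CONCEDED MASS DEPENDS ONLY ON THE TOTAL SPEND.** Two weight vectors that agree on the licensed cells and spend the same total on the deficit
cells (`Σ_{ŝ<0} ω t = Σ_{ŝ<0} ω' t`) keep the same mass — whatever cells carry the spend (no feasibility or sign hypothesis needed). [folklore] -/
theorem kept_eq_of_spend_eq (hlic : ∀ c ∈ s, 0 ≤ ŝ c → ω c = ω' c)
    (hspend : ∑ c ∈ s.filter (fun c => ¬ 0 ≤ ŝ c), ω c * t c = ∑ c ∈ s.filter (fun c => ¬ 0 ≤ ŝ c), ω' c * t c) :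
    ∑ c ∈ s, ω c * t c = ∑ c ∈ s, ω' c * t c := by
  rw [← Finset.sum_filter_add_sum_filter_not s (fun c => 0 ≤ ŝ c) (fun c => ω c * t c),
    ← Finset.sum_filter_add_sum_filter_not s (fun c => 0 ≤ ŝ c) (fun c => ω' c * t c), hspend]
  congr 1
  exact Finset.sum_congr rfl fun c hc => by rw [hlic c (Finset.mem_filter.mp hc).1 (Finset.mem_filter.mp hc).2]

omit [IsStrictOrderedRing 𝕜] in
/-- Under unit ratio the netting sum, too, depends only on the licensed part and the total deficit spend:
`Σ ω ŝ = Σ_{ŝ≥0} ω ŝ − Σ_{ŝ<0} ω t`. [folklore] -/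
theorem net_eq_licensed_sub_spend (hunit : ∀ c ∈ s, ŝ c < 0 → ŝ c = -t c) :
    ∑ c ∈ s, ω c * ŝ c = ∑ c ∈ s.filter (fun c => 0 ≤ ŝ c), ω c * ŝ c - ∑ c ∈ s.filter (fun c => ¬ 0 ≤ ŝ c), ω c * t c := by
  rw [← Finset.sum_filter_add_sum_filter_not s (fun c => 0 ≤ ŝ c) (fun c => ω c * ŝ c), sub_eq_add_neg, ← Finset.sum_neg_distrib]
  congr 1
  exact Finset.sum_congr rfl fun c hc => by
    rw [hunit c (Finset.mem_filter.mp hc).1 (not_le.mp (Finset.mem_filter.mp hc).2), mul_neg]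

omit [IsStrictOrderedRing 𝕜] in
/-- **REDISTRIBUTION.** If `ω` is feasible and optimal and `ω'` (`0 ≤ ω' ≤ 1`) agrees with `ω` on the licensed cells and has the same total deficit spend,
then `ω'` is feasible and optimal as well: the optimal face is «licensed part fixed, total spend `= C_σ`», a slab, not a point. [folklore] -/
theorem optimal_of_redistribution (hunit : ∀ c ∈ s, ŝ c < 0 → ŝ c = -t c) (hnet : 0 ≤ ∑ c ∈ s, ω c * ŝ c)
    (hopt : ∑ c ∈ s, ω c * t c = ∑ c ∈ s.filter (fun c => 0 ≤ ŝ c), (t c + ŝ c))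
    (hlic : ∀ c ∈ s, 0 ≤ ŝ c → ω' c = ω c)
    (hspend : ∑ c ∈ s.filter (fun c => ¬ 0 ≤ ŝ c), ω' c * t c = ∑ c ∈ s.filter (fun c => ¬ 0 ≤ ŝ c), ω c * t c) :
    0 ≤ ∑ c ∈ s, ω' c * ŝ c ∧ ∑ c ∈ s, ω' c * t c = ∑ c ∈ s.filter (fun c => 0 ≤ ŝ c), (t c + ŝ c) := by
  have hnet' : ∑ c ∈ s, ω' c * ŝ c = ∑ c ∈ s, ω c * ŝ c := by
    rw [net_eq_licensed_sub_spend hunit, net_eq_licensed_sub_spend hunit, hspend]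
    congr 1
    exact Finset.sum_congr rfl fun c hc => by rw [hlic c (Finset.mem_filter.mp hc).1 (Finset.mem_filter.mp hc).2]
  exact ⟨hnet'.symm ▸ hnet, (kept_eq_of_spend_eq hlic hspend).trans hopt⟩

end Degeneracy

/-! ## §3. ATTAINMENT without greed: the uniform scheme, and `max (P) = min(M, mass(σ) + C_σ)` -/

section Attainment

variable {s : Finset ι} {t ŝ : ι → 𝕜}

/-- **If the debt fits in the surplus** (`Σ_{ŝ<0} t ≤ C_σ = Σ_{ŝ≥0} ŝ`), keeping EVERYTHING (`ω ≡ 1`) is feasible, and then the value is `M = Σ t`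
(which is `≤ mass(σ) + C_σ`). [folklore] -/
theorem all_optimal_of_debt_le (ht : ∀ c ∈ s, 0 ≤ t c) (hunit : ∀ c ∈ s, ŝ c < 0 → ŝ c = -t c)
    (hdebt : ∑ c ∈ s.filter (fun c => ¬ 0 ≤ ŝ c), t c ≤ ∑ c ∈ s.filter (fun c => 0 ≤ ŝ c), ŝ c) :
    0 ≤ ∑ c ∈ s, (1 : 𝕜) * ŝ c ∧
      (∀ ω : ι → 𝕜, (∀ c ∈ s, 0 ≤ ω c) → (∀ c ∈ s, ω c ≤ 1) → ∑ c ∈ s, ω c * t c ≤ ∑ c ∈ s, (1 : 𝕜) * t c) ∧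
        ∑ c ∈ s, t c ≤ ∑ c ∈ s.filter (fun c => 0 ≤ ŝ c), (t c + ŝ c) := by
  have hnet : 0 ≤ ∑ c ∈ s, (1 : 𝕜) * ŝ c := by
    rw [net_eq_licensed_sub_spend hunit]
    simp only [one_mul]
    linarith
  refine ⟨hnet, fun ω h0 h1 => ?_, ?_⟩
  · simp only [one_mul]
    exact kept_le_total ht h0 h1
  · rw [Finset.sum_add_distrib, ← Finset.sum_filter_add_sum_filter_not s (fun c => 0 ≤ ŝ c) t]
    linarith

/-- **THE UNIFORM SCHEME IS OPTIMAL when the debt exceeds the surplus.** With `Debt := Σ_{ŝ<0} t > C_σ := Σ_{ŝ≥0} ŝ ≥ 0`, the scheme `ω = 1` on licensed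
cells and `ω = θ := C_σ/Debt ∈ [0,1)` on EVERY deficit cell (no ranking of cells whatsoever) is feasible with full spend and keeps exactly
`mass(σ) + C_σ` — the optimum of §1. Greedy-by-label, anti-greedy, uniform: all optimal (§2). [folklore] -/
theorem uniform_optimal (hunit : ∀ c ∈ s, ŝ c < 0 → ŝ c = -t c)
    (hdebt : ∑ c ∈ s.filter (fun c => 0 ≤ ŝ c), ŝ c < ∑ c ∈ s.filter (fun c => ¬ 0 ≤ ŝ c), t c) :
    let θ := (∑ c ∈ s.filter (fun c => 0 ≤ ŝ c), ŝ c) / ∑ c ∈ s.filter (fun c => ¬ 0 ≤ ŝ c), t c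
    (∀ c ∈ s, 0 ≤ (if 0 ≤ ŝ c then 1 else θ)) ∧ (∀ c ∈ s, (if 0 ≤ ŝ c then 1 else θ) ≤ 1) ∧
      ∑ c ∈ s, (if 0 ≤ ŝ c then 1 else θ) * ŝ c = 0 ∧
        ∑ c ∈ s, (if 0 ≤ ŝ c then 1 else θ) * t c = ∑ c ∈ s.filter (fun c => 0 ≤ ŝ c), (t c + ŝ c) := by
  intro θ
  have hC : 0 ≤ ∑ c ∈ s.filter (fun c => 0 ≤ ŝ c), ŝ c := Finset.sum_nonneg fun c hc => (Finset.mem_filter.mp hc).2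
  have hD : 0 < ∑ c ∈ s.filter (fun c => ¬ 0 ≤ ŝ c), t c := lt_of_le_of_lt hC hdebt
  have hθ0 : 0 ≤ θ := div_nonneg hC hD.le
  have hθ1 : θ ≤ 1 := (div_le_one hD).mpr hdebt.le
  have hθD : θ * ∑ c ∈ s.filter (fun c => ¬ 0 ≤ ŝ c), t c = ∑ c ∈ s.filter (fun c => 0 ≤ ŝ c), ŝ c :=
    div_mul_cancel₀ _ hD.ne'
  have h0 : ∀ c ∈ s, 0 ≤ (if 0 ≤ ŝ c then 1 else θ) := fun c _ => by
    split_ifs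
    exacts [zero_le_one, hθ0]
  have h1 : ∀ c ∈ s, (if 0 ≤ ŝ c then 1 else θ) ≤ 1 := fun c _ => by
    split_ifs
    exacts [le_rfl, hθ1]
  -- licensed part and total spend of the uniform scheme
  have hlicS : ∑ c ∈ s.filter (fun c => 0 ≤ ŝ c), (if 0 ≤ ŝ c then 1 else θ) * ŝ c = ∑ c ∈ s.filter (fun c => 0 ≤ ŝ c), ŝ c :=
    Finset.sum_congr rfl fun c hc => by rw [if_pos (Finset.mem_filter.mp hc).2, one_mul]
  have hlicT : ∑ c ∈ s.filter (fun c => 0 ≤ ŝ c), (if 0 ≤ ŝ c then 1 else θ) * t c = ∑ c ∈ s.filter (fun c => 0 ≤ ŝ c), t c :=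
    Finset.sum_congr rfl fun c hc => by rw [if_pos (Finset.mem_filter.mp hc).2, one_mul]
  have hspend : ∑ c ∈ s.filter (fun c => ¬ 0 ≤ ŝ c), (if 0 ≤ ŝ c then 1 else θ) * t c =
      ∑ c ∈ s.filter (fun c => 0 ≤ ŝ c), ŝ c := by
    rw [← hθD, Finset.mul_sum]
    exact Finset.sum_congr rfl fun c hc => by rw [if_neg (Finset.mem_filter.mp hc).2]
  have hnet : ∑ c ∈ s, (if 0 ≤ ŝ c then 1 else θ) * ŝ c = 0 := by
    rw [net_eq_licensed_sub_spend hunit, hlicS, hspend, sub_self]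
  refine ⟨h0, h1, hnet, ?_⟩
  rw [← Finset.sum_filter_add_sum_filter_not s (fun c => 0 ≤ ŝ c), hlicT, hspend, Finset.sum_add_distrib]

/-- **`max (P) = min(M, mass(σ) + C_σ)` is ATTAINED** (under unit ratio, `t ≥ 0`): some feasible scheme keeps exactly `min(Σ t, Σ_{ŝ≥0}(t + ŝ))`, and no
feasible scheme keeps more (`kept_le_total`, `kept_le_surplusValue`). In R29's words: LIC/netting `ε = T − C_σ` (or `0`), EX/netting (table `t ↦ u`)
`ε = (M − Π)⁺`; the dual multiplier is `1` and the weights never matter. [folklore] -/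
theorem exists_kept_eq_min (ht : ∀ c ∈ s, 0 ≤ t c) (hunit : ∀ c ∈ s, ŝ c < 0 → ŝ c = -t c) :
    ∃ ω : ι → 𝕜, (∀ c ∈ s, 0 ≤ ω c) ∧ (∀ c ∈ s, ω c ≤ 1) ∧ 0 ≤ ∑ c ∈ s, ω c * ŝ c ∧
      ∑ c ∈ s, ω c * t c = min (∑ c ∈ s, t c) (∑ c ∈ s.filter (fun c => 0 ≤ ŝ c), (t c + ŝ c)) := by
  by_cases hdebt : ∑ c ∈ s.filter (fun c => ¬ 0 ≤ ŝ c), t c ≤ ∑ c ∈ s.filter (fun c => 0 ≤ ŝ c), ŝ c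
  · obtain ⟨hnet, -, hle⟩ := all_optimal_of_debt_le ht hunit hdebt
    refine ⟨fun _ => 1, fun _ _ => zero_le_one, fun _ _ => le_rfl, hnet, ?_⟩
    rw [min_eq_left hle]
    exact Finset.sum_congr rfl fun c _ => one_mul _
  · obtain ⟨h0, h1, hnet, hval⟩ := uniform_optimal hunit (not_le.mp hdebt)
    refine ⟨_, h0, h1, hnet.symm.le, ?_⟩
    rw [hval, min_eq_right]
    rw [Finset.sum_add_distrib, ← Finset.sum_filter_add_sum_filter_not s (fun c => 0 ≤ ŝ c) t]
    linarith [not_le.mp hdebt]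

end Attainment

/-! ## §4. The referee's EX remark: the plainly netted statement beats every weighted-door concession -/

section ExactInformation

variable {s : Finset ι} {t u ω : ι → 𝕜}

/-- **NETTING WITH EXACT INFORMATION NEEDS NO WEIGHTS.** If every cell carries a certified deficit bound `u c ≤ t c` (EX: `u = demand − price`), then
for ANY scheme `ω ≤ 1` meeting the weighted door's hypothesis `Σ ω u ≤ 0` the plainly netted total is already below the door's concession:
`Σ u ≤ Σ (1 − ω)·t`. So at information level EX the least `ε` is `(Σ u)⁺ = (M − Π)⁺` by p479556 (`StatementUpTo P ε ⟺ PN Σᶠ d ≤ ε`) directly, and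
p480491's weighted door with any `ω` is weaker or equal (rh3-ref-1 02:36:02Z; R29 (1)). [folklore] -/
theorem sum_le_weightedConcession (hut : ∀ c ∈ s, u c ≤ t c) (h1 : ∀ c ∈ s, ω c ≤ 1) (hnet : ∑ c ∈ s, ω c * u c ≤ 0) :
    ∑ c ∈ s, u c ≤ ∑ c ∈ s, (1 - ω c) * t c := by
  have hsplit : ∑ c ∈ s, u c = ∑ c ∈ s, ω c * u c + ∑ c ∈ s, (1 - ω c) * u c := by
    rw [← Finset.sum_add_distrib]
    exact Finset.sum_congr rfl fun c _ => by ring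
  have hle : ∑ c ∈ s, (1 - ω c) * u c ≤ ∑ c ∈ s, (1 - ω c) * t c :=
    Finset.sum_le_sum fun c hc => mul_le_mul_of_nonneg_left (hut c hc) (sub_nonneg.mpr (h1 c hc))
  linarith

omit [LinearOrder 𝕜] [IsStrictOrderedRing 𝕜] in
/-- … and the netted total is attained by NO weighted concession unless the priced-but-unkept part vanishes: the gap is exactly
`Σ (1 − ω)·t − Σ u = −Σ ω u + Σ (1 − ω)·(t − u)` (both terms `≥ 0` under the door's hypothesis). [folklore] -/
theorem weightedConcession_sub_sum_eq :
    ∑ c ∈ s, (1 - ω c) * t c - ∑ c ∈ s, u c = -∑ c ∈ s, ω c * u c + ∑ c ∈ s, (1 - ω c) * (t c - u c) := by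
  rw [← Finset.sum_sub_distrib, ← Finset.sum_neg_distrib, ← Finset.sum_add_distrib]
  exact Finset.sum_congr rfl fun c _ => by ring

end ExactInformation

end Summit.ABC.IUTFork.Repair.RH.ToptKnapsack
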